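import Summits.BirchSwinnertonDyer.BirchSwinnertonDyer.Theorems.ErratumRoadFiveEulerHalfGenusFamilyDivisibility
import Summits.BirchSwinnertonDyer.BirchSwinnertonDyer.Theorems.ErratumRoadFiveEulerHalfGenusFrameKolyvaginCurrency
import Summits.BirchSwinnertonDyer.BirchSwinnertonDyer.Theorems.ErratumRoadFiveEulerHalfGenusFamilyH47OrdersGuard
import Summits.BirchSwinnertonDyer.BirchSwinnertonDyer.Theorems.ClassRecordThreeCornerAtThreeShimuraFamilySign
import Summits.BirchSwinnertonDyer.BirchSwinnertonDyer.Theorems.ClassRecordThreeEulerHalvesAtThreeKolyvaginFamilyInvariance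
import Summits.BirchSwinnertonDyer.BirchSwinnertonDyer.Theorems.ClassRecordThreeEulerHalvesAtThreeKolyvaginFamilyClassCertificate
import HarnessLib

/-!
# ErratumRoadFive ∕ EulerHalf ∕ genus line — (b2b-κ) brick: the COHERENT FAMILY PACKAGE on a served frame and the ORDER ∕ SIGN
# clauses of `GenusClassDataSupply` (helper, `--supports 23444`)

Cell bsd-stepL, prover seat `bsd-stepL-imc-p1` g42; plan `HOME/imc-p1/g42/B2BK-ASSEMBLY-PLAN-imc-p1-g42.md` §2–§3 (clauses (2), (3)).

WHAT.  On a served frame (`FrameProfile`: `p ≥ 5`, `ρ̄` onto, `K` imaginary quadratic) with the labelled family of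
`GenusLabelsSupplyOddAt` (`LabelsAt W (2N_W) K S.ιc yK ys ε₀`), at a square-free Zhang–Kolyvagin level `n` of index `≥ k ≥ 1`:
* `exists_familyPackage` — a COHERENT family `D` of generalised Kolyvagin data on the divisors of `n` with `(D m).y = ys m`
  (`ShimuraWalk.exists_coherent_familyData_y_eq`), carrying the datum-form labels (B4)∕(B3) (`familyLabels_of_labelsAt` at guard
  `2N_W`, adapter B), admissible `E(K[m]) ⊆ E(K̄)` at every `p^M` (no `p`-power torsion under `ρ̄` onto), `[P_m]` invariant mod `p^k`
  (`toGeomPoints_derivedPoint_familyData_mem_invPoints`), and Gross 5.4 (2) signs `τ c_k(m) = ε₀ (−1)^{ω(m)} c_k(m)`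
  (`conjAct_kolyvaginClass_familyData_eq_sign_smul`).
* `addOrderOf_kolyvaginClass_of_genusDepth` — clause (2): if the genus points at the genuine level `n` have EXACT depth `u < k`
  (`∀ δ, p^u ∣ P(n,δ)` and not `∀ δ, p^{u+1} ∣ P(n,δ)`), then `ord c_k(D n) = p^{k−u}` and `c_k(D n) ≠ 0` (adapter A + Cor. 4.5).

HONEST FRAMING: helper theorems; conditional on the printed fact (G1) where stated and on a parametrisation datum `DtW` of `W`; no crux
and no stub is closed; BSD is proved for no curve.  [cite: GrossLMS1991, §3 Prop. 3.7, §4 (4.1), §5 Prop. 5.4 (2)]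
[cite: McCallumLMS1991, §4 (4.3), Cor. 4.5, §5 (p. 305)] [cite: Jetchev2008, §3.1 item 7]
presearch: in-tree only; no new literature.
-/

set_option autoImplicit false
-- D-0017: single-problem summit, so `Summit.BirchSwinnertonDyer.BirchSwinnertonDyer.…` repeats a namespace BY DESIGN.
set_option linter.dupNamespace false

noncomputable section

open scoped Classical
open WeierstrassCurve NumberField Field Literature.NumberTheory.EllipticCurves Literature.NumberTheory.EllipticCurves.ModularForms
  Literature.NumberTheory.GaloisRepresentations Literature.NumberTheory.GaloisRepresentations.DiscreteGaloisModule
  Literature.NumberTheory.EllipticCurves.KolyvaginCocycle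
  Summit.BirchSwinnertonDyer.Rank1Residual Summit.BirchSwinnertonDyer.Rank1Residual.X11b
  Summit.BirchSwinnertonDyer.Rank1Residual.JET

namespace Summit.BirchSwinnertonDyer.BirchSwinnertonDyer.Theorems.GenusLine

variable {W A : WeierstrassCurve ℚ} {p q : ℕ} {K : Type} [Field K] [NumberField K]

/-! ## §1 The coherent family package -/

/-- **THE COHERENT FAMILY PACKAGE on a served frame** — see the module docstring. [cite: GrossLMS1991, §3 Prop. 3.7, §4, §5 Prop. 5.4 (2)]
[cite: McCallumLMS1991, §4 (4.3), (5)] -/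
theorem exists_familyPackage [W.IsElliptic] [W.IsGloballyMinimal] [A.IsElliptic] [Fact p.Prime] [Fact q.Prime]
    [NeZero (W.conductorNorm ℤ)]
    (S : GenusHeegnerSettingRC W A p q K) (hprof : FrameProfile W A p q K)
    (DtW : ModularParametrizationData W (W.conductorNorm ℤ)) [∀ j : ℕ, NumberField (ringClassField K S.ιc j)]
    {yK : (W.baseChange K).toAffine.Point}
    {ys : (m : ℕ) → (W.baseChange (ringClassField K S.ιc m)).toAffine.Point} {ε₀ : ℤ}
    (hL : ShimuraWalk.LabelsAt W (2 * W.conductorNorm ℤ) K S.ιc yK ys ε₀)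
    {k n : ℕ} (hk : 1 ≤ k) (hn : Squarefree n)
    (hKol : ∀ ℓ ∈ n.primeFactors, Zhang2014.IsKolyvaginPrime (W.conductorNorm ℤ) W K p ℓ)
    (hkn : (k : ℕ∞) ≤ Zhang2014.levelIndex W p n) (τ : K ≃ₐ[ℚ] K) (hτ : τ ≠ 1) :
    ∃ D : (m : ℕ) → m ∣ n → KolyvaginFamilyData W K S.ιc m,
      (∀ (m : ℕ) (hm : m ∣ n), (D m hm).y = ys m) ∧
      (∀ (m : ℕ) (hm : m ∣ n), ∀ (ℓ : ℕ) (hℓ : ℓ ∈ m.primeFactors)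
        (hle : ringClassField K S.ιc (m / ℓ) ≤ ringClassField K S.ιc m),
        ∑ i ∈ Finset.range (ℓ + 1), pointGalHom W (ringClassField K S.ιc m) ((D m hm).σ ℓ ^ i) (D m hm).y =
          W.frobeniusTrace ℓ • WeierstrassCurve.Affine.Point.map (W' := W)
            ((RingClassField.inclusion S.ιc hle).restrictScalars ℚ)
            (D (m / ℓ) ((Nat.div_dvd_of_dvd (Nat.dvd_of_mem_primeFactors hℓ)).trans hm)).y) ∧
      (∀ (m : ℕ) (hm : m ∣ n) (τm : ringClassField K S.ιc m ≃ₐ[ℚ] ringClassField K S.ιc m),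
        (∀ x : ringClassField K S.ιc m, ((τm x : ringClassField K S.ιc m) : ℂ) = starRingEnd ℂ x) →
        ∃ σ' ∈ ringClassGal S.ιc m, IsOfFinAddOrder
          (pointGalHom W (ringClassField K S.ιc m) τm (D m hm).y -
            ε₀ • pointGalHom W (ringClassField K S.ιc m) σ' (D m hm).y)) ∧
      (∀ (m : ℕ) (hm : m ∣ n) (M : ℕ), IsAdmissible (absoluteGaloisGroup K) (D m hm).pointsSubgroup ((p ^ M : ℕ) : ℤ)) ∧
      (∀ (m : ℕ) (hm : m ∣ n), (D m hm).toGeomPoints (D m hm).derivedPoint ∈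
        invPoints (absoluteGaloisGroup K) (D m hm).pointsSubgroup ((p ^ k : ℕ) : ℤ)) ∧
      (∀ (m : ℕ) (hm : m ∣ n),
        conjAct W τ ((p ^ k : ℕ) : ℤ) ((D m hm).kolyvaginClass (Fact.out : p.Prime) k) =
          (ε₀ * (-1) ^ m.primeFactors.card) • (D m hm).kolyvaginClass (Fact.out : p.Prime) k) := by
  have hp : p.Prime := Fact.out
  have hK : IsImaginaryQuadratic K := hprof.quad
  have hp2 : p ≠ 2 := p_ne_two_of_frameProfile hprof
  have hn0 : n ≠ 0 := hn.ne_zero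
  -- Gross currency at depth `k` and the guard `2N_W` (adapter B)
  have hKolG := grossKolyvagin_level_of_frameProfile hprof hk hKol hkn
  have hguard := guard_two_mul_level_of_frameProfile hprof hKol
  -- the coherent family and its labels
  obtain ⟨D, hDy, -, -⟩ := ShimuraWalk.exists_coherent_familyData_y_eq (W := W) hK S.ιc hn (fun ℓ hℓ ↦ (hguard ℓ hℓ).2) ys
  obtain ⟨hB4d, hB5d, hB3d⟩ := ShimuraWalk.familyLabels_of_labelsAt (W := W) hn hguard ys hL D hDy
  -- admissibility (no `p`-power torsion in `E(K[m])`, `ρ̄` onto)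
  have hA : ∀ (m : ℕ) (hm : m ∣ n) (M : ℕ),
      IsAdmissible (absoluteGaloisGroup K) (D m hm).pointsSubgroup ((p ^ M : ℕ) : ℤ) := fun m hm M ↦
    ShimuraWalk.isAdmissible_pointsSubgroup_familyData hK (D m hm) fun n' a ha ↦
      RingClassNoTorsion.eq_zero_of_zsmul_pow_eq_zero_ringClassField W hK S.ιc (ne_zero_of_dvd_ne_zero hn0 hm) hp hp2
        hprof.surj n' a ha
  -- invariance mod `p^k`
  have hP := ShimuraWalk.toGeomPoints_derivedPoint_familyData_mem_invPoints hK S.ιc hp hk DtW hn hKolG D hB4d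
  -- signs
  have hsign := ShimuraWalk.conjAct_kolyvaginClass_familyData_eq_sign_smul hK S.ιc hp hk DtW hn hKolG D hτ ε₀ hB4d hB3d
    (fun m hm ↦ hA m hm k)
  exact ⟨D, hDy, hB4d, hB3d, hA, hP, hsign⟩

/-! ## §2 Clause (2): the order of `c_k(n)` from the EXACT genus depth -/

/-- **Clause (2) of `GenusClassDataSupply`** — `ord c_k(D n) = p^{k−u}` and `c_k(D n) ≠ 0` when the genus points at the genuine level `n`
have exact depth `u < k`: adapter A (`forall_genusDatum_pDiv_iff_pDiv`) turns the genus depth into `ShimuraWalk.PDiv`, corner3-p2's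
dictionary into `(D n).PDiv`, and McCallum Cor. 4.5 (`KolyvaginFamilyData.addOrderOf_kolyvaginClass_of_exactDepth`) reads the order.
[cite: McCallumLMS1991, Cor. 4.5, §5 (p. 305)] [cite: Jetchev2008, §3.1 item 7] -/
theorem addOrderOf_kolyvaginClass_of_genusDepth [W.IsElliptic] [W.IsGloballyMinimal] [A.IsElliptic] [Fact p.Prime] [Fact q.Prime]
    [NeZero (W.conductorNorm ℤ)]
    (hG1 : ∀ (N : ℕ) [NeZero N] (W : WeierstrassCurve ℚ) (K : Type) [Field K] [NumberField K],
      phi_heegnerPointOfConductor_mem_range_map_ringClassField_birch N W K)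
    (S : GenusHeegnerSettingRC W A p q K) (hprof : FrameProfile W A p q K)
    (DtW : ModularParametrizationData W (W.conductorNorm ℤ)) [∀ j : ℕ, NumberField (ringClassField K S.ιc j)]
    {yK : (W.baseChange K).toAffine.Point}
    {ys : (m : ℕ) → (W.baseChange (ringClassField K S.ιc m)).toAffine.Point} {ε₀ : ℤ}
    (hL : ShimuraWalk.LabelsAt W (2 * W.conductorNorm ℤ) K S.ιc yK ys ε₀)
    (hid : haveI := S.nz; haveI := S.nf; ∀ (c : ℕ), c ≠ 0 → c.Coprime (S.E'.conductorNorm ℤ) →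
      ∀ δ : GenusKolyvaginDatum S.E' K S.ιc S.Dt S.β S.d₁ c,
        genusTransport W S.E' S.D S.C₂ S.hWd K S.ιc δ = ys c ∨ genusTransport W S.E' S.D S.C₂ S.hWd K S.ιc δ = -ys c)
    {k n : ℕ} (hk : 1 ≤ k) (hn : Squarefree n) (hnE : haveI := S.nz; n.Coprime (S.E'.conductorNorm ℤ))
    (hKol : ∀ ℓ ∈ n.primeFactors, Zhang2014.IsKolyvaginPrime (W.conductorNorm ℤ) W K p ℓ)
    (hkn : (k : ℕ∞) ≤ Zhang2014.levelIndex W p n) {u : ℕ} (huk : u < k)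
    (hdiv : haveI := S.nz; haveI := S.nf; ∀ δ : GenusKolyvaginDatum S.E' K S.ιc S.Dt S.β S.d₁ n,
      ∃ z : (W.baseChange (ringClassField K S.ιc n : Type)).toAffine.Point,
        ((p ^ u : ℕ) : ℤ) • z = genusFamilyPoint W S.E' S.D S.C₂ S.hWd K S.ιc δ)
    (hndiv : haveI := S.nz; haveI := S.nf; ¬ ∀ δ : GenusKolyvaginDatum S.E' K S.ιc S.Dt S.β S.d₁ n,
      ∃ z : (W.baseChange (ringClassField K S.ιc n : Type)).toAffine.Point,
        ((p ^ (u + 1) : ℕ) : ℤ) • z = genusFamilyPoint W S.E' S.D S.C₂ S.hWd K S.ιc δ)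
    (D : (m : ℕ) → m ∣ n → KolyvaginFamilyData W K S.ιc m) (hDy : ∀ (m : ℕ) (hm : m ∣ n), (D m hm).y = ys m)
    (hA : IsAdmissible (absoluteGaloisGroup K) (D n dvd_rfl).pointsSubgroup ((p ^ k : ℕ) : ℤ))
    (hP : (D n dvd_rfl).toGeomPoints (D n dvd_rfl).derivedPoint ∈
      invPoints (absoluteGaloisGroup K) (D n dvd_rfl).pointsSubgroup ((p ^ k : ℕ) : ℤ)) :
    addOrderOf ((D n dvd_rfl).kolyvaginClass (Fact.out : p.Prime) k) = p ^ (k - u) ∧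
      (D n dvd_rfl).kolyvaginClass (Fact.out : p.Prime) k ≠ 0 := by
  haveI := S.nz; haveI := S.nf
  have hp : p.Prime := Fact.out
  have hK : IsImaginaryQuadratic K := hprof.quad
  have hn0 : n ≠ 0 := hn.ne_zero
  have hKolG := grossKolyvagin_level_of_frameProfile hprof hk hKol hkn
  have hguard := guard_two_mul_level_of_frameProfile hprof hKol
  -- the weak (B4) label at level `n` for `ys`, read off `LabelsAt` at guard `2N_W`
  have hB4 : ∀ ℓ ∈ n.primeFactors, ∀ σ : ringClassField K S.ιc n ≃ₐ[ℚ] ringClassField K S.ιc n,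
      Subgroup.zpowers σ = ringClassGalOver S.ιc n (n / ℓ) →
      ∃ y' : (W.baseChange (ringClassField K S.ιc n : Type)).toAffine.Point,
        ∑ i ∈ Finset.range (ℓ + 1), pointGalHom W (ringClassField K S.ιc n) (σ ^ i) (ys n) = W.frobeniusTrace ℓ • y' := by
    intro ℓ hℓ σ hσ
    letI : Algebra K ℂ := S.ιc.toAlgebra
    exact ⟨_, hL.2.2.2.2.1 n hn hguard ℓ hℓ
      (ringClassField_mono hK S.ιc (Nat.div_dvd_of_dvd (Nat.dvd_of_mem_primeFactors hℓ)) hn0) σ hσ⟩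
  -- adapter A at `μ = u` and `μ = u + 1`
  have hdict := fun (μ : ℕ) (hμ : μ ≤ k) ↦
    forall_genusDatum_pDiv_iff_pDiv hG1 S hK DtW hk hn hnE hKolG ys hB4 (hid n hn0 hnE) hμ
  have hPDu : ShimuraWalk.PDiv hK S.ιc W ys p n u := (hdict u huk.le).mp hdiv
  have hPDu1 : ¬ ShimuraWalk.PDiv hK S.ιc W ys p n (u + 1) := fun h ↦ hndiv ((hdict (u + 1) huk).mpr h)
  -- corner3's dictionary: `ShimuraWalk.PDiv ↔ (D n).PDiv`
  have hdvd : (D n dvd_rfl).PDiv p u :=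
    (ShimuraWalk.pDiv_iff_familyData_pDiv hK S.ιc DtW hp hk hn hKolG ys (D n dvd_rfl) (hDy n dvd_rfl) hB4 huk.le).mp hPDu
  have hndvd : ¬ (D n dvd_rfl).PDiv p (u + 1) := fun h ↦
    hPDu1 ((ShimuraWalk.pDiv_iff_familyData_pDiv hK S.ιc DtW hp hk hn hKolG ys (D n dvd_rfl) (hDy n dvd_rfl) hB4 huk).mpr h)
  exact ⟨(D n dvd_rfl).addOrderOf_kolyvaginClass_of_exactDepth hp huk.le hA hP hdvd hndvd,
    (D n dvd_rfl).kolyvaginClass_ne_zero_of_exactDepth hp huk hA hP hdvd hndvd⟩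

end Summit.BirchSwinnertonDyer.BirchSwinnertonDyer.Theorems.GenusLine

end
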